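import Literature.AlgebraicGeometry.AbelianSchemes.PoincareBaseQuotientDescent
import Literature.AlgebraicGeometry.AbelianSchemes.RigidDescentAlongUnitSectionOfBaseChange
import HarnessLib

/-!
# The Poincaré sheaf descends along a free finite quotient OF THE BASE — WITHOUT `Â` REDUCED
# ([MFK94] Ch. 7 §3 remark after Thm. 7.9, Lemma 7.11; [Mumford AV] §8 pp. 78–80, §12 Thm. 1, §13 p. 125; SGA 1 VIII 1.1/7.8)

Topic `AlgebraicGeometry/AbelianSchemes`; namespace `Literature.AlgebraicGeometry.AbelianSchemes.AbelianSchemeOver`.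
THEOREMS ONLY (no definition, no named fact, no instance, no notation, no `sorry`; net Literature debt 0).

★ `PoincareBaseQuotientDescent` descends the Poincaré sheaf `𝒫` of a dual pair `D = (Â, 𝒫)` of `A/S` along a free finite
quotient `p : S → Q = S/G` of the BASE to a rigidified line bundle `𝒫_B` on `B ×_Q B̂` with `(π ×_p π̂)^* 𝒫_B ≅ 𝒫`, under the
hypothesis that `Â` is REDUCED and locally Noetherian — used at exactly one point, the «cocycle for free» §2 there (Mumford's
normalisation of the `G`-linearisation of `𝒫` along `ε_A × 1`), which invokes ★ `RigidDescentAlongUnitSection` for the abelian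
scheme `A ×_S Â → Â`, i.e. for the BASE CHANGE `A.baseChange D.hat.X.hom`, whose rigid-descent lemma was stated over reduced
bases only.  THIS FILE is the same three theorems with `[IsReduced D.hat.X.left] [IsLocallyNoetherian D.hat.X.left]` REPLACED BY
`[IsLocallyNoetherian S]`: over a locally Noetherian `S` the abelian scheme `A ×_S Â → Â` is Stein whatever `Â` is (★
`AbelianSchemeSteinOfNoetherian`), so rigid descent along its unit section holds for ANY `Â` (★
`RigidDescentAlongUnitSectionOfBaseChange.exists_equivariantStructure_of_restrictAlong_unitSection_baseChange`); the proof
bodies are otherwise those of ★ `PoincareBaseQuotientDescent` §2–§4 token for token (its §1 — the diagonal action, freeness,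
equivariance of `ε_A × 1`, `(ε_A × 1) ≫ ϖ = π̂ ≫ (ε_B × 1)` — carries no hypothesis on `Â` and is used by name).

SETTING (as in ★ `PoincareBaseQuotientDescent`).  `p : S → Q` an AFFINE geometric quotient of `S` by a FREE action `ρ` of
the finite group `G`; `S` LOCALLY NOETHERIAN; `A/S` with a dual pair `D = (Â, 𝒫)` (NO hypothesis on `Â`); `B`, `B̂` abelian
schemes over `Q` and `π : A → B`, `π̂ : Â → B̂` exhibiting `A`, `Â` as the base changes of `B`, `B̂` along `p` as group schemes
(`hAB`, `hÂB̂`); actions `ρA`, `ρÂ` of `G` on `A`, `Â` over `π`, `π̂` covering `ρ` by isomorphisms of group schemes (`hA`,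
`hÂ`); the Poincaré clause `hP : ∀ g, (ρA(g) ×_{ρ(g)} ρÂ(g))^*𝒫 ≅ 𝒫`.  Write `ϖ := π ×_p π̂ : A ×_S Â → B ×_Q B̂`.

* §0 (junction, private) (β)/(T1) ★ `ActionOver.exists_descent_of_free_of_hasRank` fed with a bundled ★ `EquivariantStructure`
  for a VARIABLE action (verbatim the private junction of ★ `PoincareBaseQuotientDescent`).
* §1 `exists_equivariantStructure_poincare'` — the normalised `G`-linearisation of `𝒫` for the diagonal action EXISTS, `Â`
  arbitrary (`S` locally Noetherian).
* §2 `exists_poincare_desc_of_free_base_quotient'` — `𝒫 ≅ ϖ^* 𝒫₀` for a quasi-coherent line bundle `𝒫₀` on `B ×_Q B̂`.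
* §3 **`exists_rigidified_poincare_desc_of_free_base_quotient'`** — THE HEAD: a line bundle `𝒫_B` on `B ×_Q B̂`, RIGIDIFIED
  along `ε_B × 1_{B̂}`, with `ϖ^* 𝒫_B ≅ 𝒫`; `Â` arbitrary.

Cell `hodgecm-mathlib` (D-0151), FLOOR 0 programme P1, sub-line `Cruxes/HDel/Lines/F3DualAbelianScheme` (author of record
B-plan1 (g19)), stub (M) `stub_F3M`, inner step (M-d) «Galois base-quotient descent of the étale-local dual pair from `S′` to the
affine opens of `Spec R`»: over a NON-reduced Noetherian `ℚ`-algebra `R` the étale-local dual `Â′` is not reduced, so ★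
`DualPairBaseQuotientDescent.exists_dualPair_fields_of_free_base_quotient` must lose its `[IsReduced D.hat.X.left]` hypothesis;
this file is the sheaf half of that repair (sequel ★-to-be `DualPairBaseQuotientDescentOfNoetherian`).  Count-neutral; HC_CM is
proved only modulo the 7 printed citations until rung 0 closes; this file discharges none of them.

Mathlib searched (pin): `pullback.map`, `pullback.hom_ext`, `MorphismProperty.IsStableUnderBaseChange.of_isPullback`
(used); Mathlib has no quotients of schemes by finite groups, no linearisations and no dual abelian schemes.

## References
* D. Mumford, J. Fogarty, F. Kirwan, *Geometric Invariant Theory*, 3rd ed. (1994), Ch. 1 §3 Def. 1.6 (p. 30);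
  Ch. 6 §2 (p. 121); Ch. 7 §1 Prop. 7.1 (p. 127), §3 remark after Thm. 7.9 and Lemma 7.11 (pp. 139–140).
  [MumfordFogartyKirwan1994]
* D. Mumford, *Abelian Varieties* (1970), §5 Cor. 6 (p. 54), §7 Thm. p. 66, §8 pp. 78–80, §12 Thm. 1 (p. 112), §13 (p. 125).
  [MumfordAV1970]
* A. Grothendieck, *SGA 1*, Exp. V §1, Prop. 2.6, Déf. 2.7; Exp. VIII Thm. 1.1, Prop. 1.10, Cor. 7.8. [SGA1]
* J. S. Milne, *Abelian Varieties* (v2.00, 2008), I §8 pp. 36–37. [MilneAV2008]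
* U. Görtz, T. Wedhorn, *Algebraic Geometry II* (2023), Cor. 24.63 (p. 404). [GortzWedhorn2023]
-/

noncomputable section

universe u

open CategoryTheory Limits AlgebraicGeometry MonoidalCategory CartesianMonoidalCategory MonObj

namespace Literature.AlgebraicGeometry.AbelianSchemes.AbelianSchemeOver

open Literature.AlgebraicGeometry.RelativeSpec Literature.AlgebraicGeometry.RelativeSpec.ActionOver
  Literature.AlgebraicGeometry.Modules Literature.AlgebraicGeometry.Motives
  Literature.AlgebraicGeometry.AbelianVarieties

set_option backward.isDefEq.respectTransparency false

/-! ### §0 Junction: (β) fed with a bundled equivariant structure, for a VARIABLE action -/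

section Aux

variable {X Y : Scheme.{u}} {r : X ⟶ Y} {G : Type u} [Group G] [Fintype G] [IsAffineHom r] (τ : ActionOver r G)
  (hτ : τ.IsGeometricQuotient r)
  (hfr : ∀ (V : Y.Opens), IsAffineOpen V → ∀ g : G, g ≠ 1 →
    Ideal.span (Set.range fun b : Γ(X, r ⁻¹ᵁ V) ↦ τ.act g V b - b) = ⊤)
  (E : X.Modules)

include hτ hfr in
/-- (β)/(T1) for a bundled equivariant structure and a VARIABLE action `τ` (so that the instantiation at the diagonal
action is a syntactic match): a rank-`n` module with a `G`-linearisation on the total space of a free affine geometric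
quotient `r : X → Y` is `r^* F` for a quasi-coherent `F` of rank `n` (verbatim the private junction of ★
`PoincareBaseQuotientDescent`). [cite: MumfordAV1970, §12 Thm. 1 (p. 112)] [cite: SGA1, Exp. VIII Prop. 1.10] -/
private theorem exists_descent_of_equivariantStructure' (Ψ : τ.EquivariantStructure E) {n : ℕ} (hE : HasRank E n) :
    ∃ (F : Y.Modules) (_ : F.IsQuasicoherent) (_ : HasRank F n), Nonempty ((Scheme.Modules.pullback r).obj F ≅ E) := by
  haveI := isQuasicoherent_of_hasRank hE
  obtain ⟨F, hF, hF1, e, -⟩ :=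
    τ.exists_descent_of_free_of_hasRank E Ψ.iso hτ hfr Ψ.iso_one_hom Ψ.iso_mul_hom hE
  exact ⟨F, hF, hF1, ⟨e⟩⟩

end Aux

variable {S Q : Scheme.{u}} {p : S ⟶ Q} {G : Type u} [Group G] [Fintype G] {ρ : ActionOver p G}
  (hq : ρ.IsGeometricQuotient p) [IsAffineHom p]
  (hfree : ∀ (V : Q.Opens), IsAffineOpen V → ∀ g : G, g ≠ 1 →
    Ideal.span (Set.range fun s : Γ(S, p ⁻¹ᵁ V) ↦ ρ.act g V s - s) = ⊤)
  (A : AbelianSchemeOver S) (D : A.DualPair)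
  (B : AbelianSchemeOver Q) {π : A.X.left ⟶ B.X.left} (ρA : ActionOver π G) (hAB : A.IsBaseChangeVia B p π)
  (hA : ∀ g : G, A.IsBaseChangeVia A (ρ.aut g).hom (ρA.aut g).hom)
  (Bh : AbelianSchemeOver Q) {πh : D.hat.X.left ⟶ Bh.X.left} (ρh : ActionOver πh G)
  (hABh : D.hat.IsBaseChangeVia Bh p πh)
  (hAh : ∀ g : G, D.hat.IsBaseChangeVia D.hat (ρ.aut g).hom (ρh.aut g).hom)

/-! ### §1 The cocycle for free: the normalised `G`-linearisation of `𝒫`, `Â` arbitrary -/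

omit [Fintype G] [IsAffineHom p] in
/-- **THE POINCARÉ SHEAF IS `G`-LINEARISED (normalised along `ε_A × 1`), `Â` ARBITRARY.**  If for every `g` SOME isomorphism
`(ρA(g) ×_{ρ(g)} ρÂ(g))^* 𝒫 ≅ 𝒫` exists (the Poincaré clause of the `G`-isomorphisms of triples) and the base `S` is locally
Noetherian, then `𝒫` carries a `G`-equivariant structure `Φ` for the diagonal action — unit AND COCYCLE conditions included —
whose restriction along the equivariant unit section `ε_A × 1 : Â → A ×_S Â` is the trivial linearisation of
`(ε_A × 1)^*𝒫 ≅ 𝒪_Â = π̂^* 𝒪_{B̂}`: Mumford's normalisation of a linearisation along `{0} × X`, in families over the (possibly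
NON-reduced) test scheme `Â` (★ `exists_equivariantStructure_of_restrictAlong_unitSection_baseChange` for the base change
`A ×_S Â = A.baseChange D.hat.X.hom → Â`, Stein because `S` is locally Noetherian).  ★ `exists_equivariantStructure_poincare`
with `[IsReduced D.hat.X.left] [IsLocallyNoetherian D.hat.X.left]` replaced by `[IsLocallyNoetherian S]`.
[cite: MumfordAV1970, §8 (pp. 78–80) and §13 (p. 125)] [cite: MumfordFogartyKirwan1994, Ch. 1 §3 Definition 1.6 (p. 30)]
[cite: MilneAV2008, I §8 pp. 36–37] -/
theorem exists_equivariantStructure_poincare' [IsLocallyNoetherian S]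
    (hP : ∀ g : G, Nonempty ((Scheme.Modules.pullback
      (pullback.map A.X.hom D.hat.X.hom A.X.hom D.hat.X.hom (ρA.aut g).hom (ρh.aut g).hom (ρ.aut g).hom
        (hA g).fst.symm (hAh g).fst.symm)).obj D.P ≅ D.P)) :
    ∃ Φ : (ActionOver.onPullback A.X.hom D.hat.X.hom ρA.aut ρh.aut ρ.aut (fun g => (hA g).fst) (fun g => (hAh g).fst)
        (pullback.map A.X.hom D.hat.X.hom B.X.hom Bh.X.hom π πh p hAB.fst.symm hABh.fst.symm)
        (ActionOver.IsGeometricQuotient.pullbackMapHom_comp_map ρA (fun g => (hA g).fst) hAB.fst.symm ρh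
          (fun g => (hAh g).fst) hABh.fst.symm)).EquivariantStructure D.P,
      ∀ g : G, restrictAlong
        (ActionOver.onPullback A.X.hom D.hat.X.hom ρA.aut ρh.aut ρ.aut (fun g => (hA g).fst) (fun g => (hAh g).fst)
          (pullback.map A.X.hom D.hat.X.hom B.X.hom Bh.X.hom π πh p hAB.fst.symm hABh.fst.symm)
          (ActionOver.IsGeometricQuotient.pullbackMapHom_comp_map ρA (fun g => (hA g).fst) hAB.fst.symm ρh
            (fun g => (hAh g).fst) hABh.fst.symm))
        ρh (A.baseChange D.hat.X.hom).unitSection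
        (autHom_comp_unitSection_baseChange_hat A D B ρA hAB hA Bh ρh hABh hAh) D.P g (Φ.iso g).hom =
        (((ActionOver.EquivariantStructure.ofPullback ρh (SheafOfModules.unit _)).ofIso
          (RigidifiedLineBundle.pullbackUnitIso πh ≪≫ (DualPair.selfBundle D).rigid.some.symm)).iso g).hom :=
  A.exists_equivariantStructure_of_restrictAlong_unitSection_baseChange D.hat.X.hom _ ρh
    (autHom_comp_unitSection_baseChange_hat A D B ρA hAB hA Bh ρh hABh hAh) (DualPair.selfBundle D).hasRank_one hP _

/-! ### §2 Descent of `𝒫` to a line bundle on `B ×_Q B̂`, `Â` arbitrary -/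

include hq hfree in
/-- **THE POINCARÉ SHEAF DESCENDS TO `B ×_Q B̂`, `Â` ARBITRARY**: in the SETTING of the module docstring (`S` locally Noetherian,
no hypothesis on `Â`) there is a quasi-coherent LINE BUNDLE `𝒫₀` on `B ×_Q B̂` with `ϖ^* 𝒫₀ ≅ 𝒫`, `ϖ = π ×_p π̂` (Galois descent
★ (β)/(T1) along the free affine geometric quotient `ϖ` for the normalised linearisation of §1).  ★
`exists_poincare_desc_of_free_base_quotient` without `IsReduced`. [cite: MumfordAV1970, §12 Thm. 1 (p. 112) and §13 (p. 125)]
[cite: SGA1, Exp. VIII Thm. 1.1 and Prop. 1.10] [cite: MumfordFogartyKirwan1994, Ch. 7 §1 Prop. 7.1 (p. 127)] -/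
theorem exists_poincare_desc_of_free_base_quotient' [IsLocallyNoetherian S]
    (hP : ∀ g : G, Nonempty ((Scheme.Modules.pullback
      (pullback.map A.X.hom D.hat.X.hom A.X.hom D.hat.X.hom (ρA.aut g).hom (ρh.aut g).hom (ρ.aut g).hom
        (hA g).fst.symm (hAh g).fst.symm)).obj D.P ≅ D.P)) :
    ∃ (P₀ : (B.prodLeft Bh).Modules) (_ : P₀.IsQuasicoherent) (_ : HasRank P₀ 1),
      Nonempty ((Scheme.Modules.pullback
        (pullback.map A.X.hom D.hat.X.hom B.X.hom Bh.X.hom π πh p hAB.fst.symm hABh.fst.symm)).obj P₀ ≅ D.P) := by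
  obtain ⟨Φ, -⟩ := exists_equivariantStructure_poincare' A D B ρA hAB hA Bh ρh hABh hAh hP
  haveI : IsAffineHom (pullback.map A.X.hom D.hat.X.hom B.X.hom Bh.X.hom π πh p hAB.fst.symm hABh.fst.symm) :=
    MorphismProperty.IsStableUnderBaseChange.of_isPullback
      (isPullback_fst_comp_map hAB.snd.1.flip hABh.snd.1.flip) inferInstance
  exact exists_descent_of_equivariantStructure' _
    (isGeometricQuotient_onPullback_prodQuotientMap hq hfree A D B ρA hAB hA Bh ρh hABh hAh)
    (free_onPullback_prodQuotientMap hfree A D B ρA hAB hA Bh ρh hABh hAh) D.P Φ D.hasRank_one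

/-! ### §3 The rigidified descended Poincaré sheaf `𝒫_B`, `Â` arbitrary -/

include hq hfree in
/-- **THE RIGIDIFIED DESCENDED POINCARÉ SHEAF, `Â` ARBITRARY.**  In the SETTING of the module docstring (free finite quotient
`p : S → Q = S/G` of the LOCALLY NOETHERIAN base `S`; `A`, `Â` descending to `B`, `B̂` as group schemes; `G` acting on `A`,
`Â` over the quotient maps, covering `ρ` by isomorphisms of group schemes; the Poincaré clause `(ρA(g) ×_{ρ(g)} ρÂ(g))^*𝒫 ≅ 𝒫`
for all `g`; NO reducedness of `Â`) there is a LINE BUNDLE `𝒫_B` on `B ×_Q B̂` which is RIGIDIFIED along `ε_B × 1_{B̂}` —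
`(ε_B × 1)^* 𝒫_B ≅ 𝒪_{B̂}`, clause (b) of ★ `DualPair` — and satisfies `(π ×_p π̂)^* 𝒫_B ≅ 𝒫`.  (`𝒫_B := rigidify 𝒫₀` for the
`𝒫₀` of §2, ★ `RigidifyAlongUnitSlice`; the comparison survives because `𝒫` is rigidified — the determinant-class computation of
★ `exists_rigidified_poincare_desc_of_free_base_quotient` verbatim.)  This is the sheaf half of «the dual pair descends along
a free base quotient» over a possibly NON-reduced base, as the étale-local step of Mumford's construction `Â = A/K(L)` over a
Noetherian `ℚ`-algebra needs it. [cite: MumfordFogartyKirwan1994, Ch. 7 §3, remark after Thm. 7.9 and Lemma 7.11 (pp. 139–140)]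
[cite: MumfordFogartyKirwan1994, Ch. 6 §2 (p. 121)] [cite: MumfordAV1970, §12 Thm. 1 (p. 112) and §13 (p. 125)]
[cite: SGA1, Exp. VIII Cor. 7.8] -/
theorem exists_rigidified_poincare_desc_of_free_base_quotient' [IsLocallyNoetherian S]
    (hP : ∀ g : G, Nonempty ((Scheme.Modules.pullback
      (pullback.map A.X.hom D.hat.X.hom A.X.hom D.hat.X.hom (ρA.aut g).hom (ρh.aut g).hom (ρ.aut g).hom
        (hA g).fst.symm (hAh g).fst.symm)).obj D.P ≅ D.P)) :
    ∃ PB : (B.prodLeft Bh).Modules, HasRank PB 1 ∧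
      Nonempty ((Scheme.Modules.pullback (B.unitSlice Bh)).obj PB ≅ SheafOfModules.unit _) ∧
      Nonempty ((Scheme.Modules.pullback
        (pullback.map A.X.hom D.hat.X.hom B.X.hom Bh.X.hom π πh p hAB.fst.symm hABh.fst.symm)).obj PB ≅ D.P) := by
  obtain ⟨P₀, _, h₀, ⟨e⟩⟩ := exists_poincare_desc_of_free_base_quotient' hq hfree A D B ρA hAB hA Bh ρh hABh hAh hP
  refine ⟨B.rigidify Bh P₀, hasRank_rigidify h₀, nonempty_pullback_unitSlice_rigidify_iso h₀, ?_⟩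
  -- the comparison survives the rigidification: a determinant-class computation
  have hP₁ := HasRank.isFiniteLocallyFree' h₀
  have hR := hasRank_rigidify (A := B) (B := Bh) h₀
  have hR₁ := HasRank.isFiniteLocallyFree' hR
  have hD₁ := HasRank.isFiniteLocallyFree' D.hasRank_one
  -- `ϖ^*[𝒫₀] = [𝒫]`
  have h1 : CechPic.pullback (pullback.map A.X.hom D.hat.X.hom B.X.hom Bh.X.hom π πh p hAB.fst.symm hABh.fst.symm)
      (detClass hP₁) = detClass hD₁ :=
    (detClass_pullback
      (f := pullback.map A.X.hom D.hat.X.hom B.X.hom Bh.X.hom π πh p hAB.fst.symm hABh.fst.symm)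
      (hE := hP₁)).symm.trans (detClass_eq_of_iso e _ _)
  -- `ϖ ≫ pr ≫ (ε_B × 1) = pr ≫ (ε_A × 1) ≫ ϖ`
  have hcomp : pullback.map A.X.hom D.hat.X.hom B.X.hom Bh.X.hom π πh p hAB.fst.symm hABh.fst.symm ≫
      pullback.snd B.X.hom Bh.X.hom ≫ B.unitSlice Bh =
      pullback.snd A.X.hom D.hat.X.hom ≫ A.unitSlice D.hat ≫
        pullback.map A.X.hom D.hat.X.hom B.X.hom Bh.X.hom π πh p hAB.fst.symm hABh.fst.symm := by
    rw [pullback.lift_snd_assoc, Category.assoc, ← unitSection_baseChange_hat_comp_prodQuotientMap A D B hAB Bh hABh,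
      DualPair.unitSection_baseChange_hat_eq_unitSlice]
  -- the twist dies after `ϖ^*`
  have h2 : CechPic.pullback (pullback.map A.X.hom D.hat.X.hom B.X.hom Bh.X.hom π πh p hAB.fst.symm hABh.fst.symm)
      (CechPic.pullback (pullback.snd B.X.hom Bh.X.hom) (CechPic.pullback (B.unitSlice Bh) (detClass hP₁))) = 1 := by
    rw [← CechPic.pullback_comp, ← CechPic.pullback_comp, Category.assoc, hcomp, CechPic.pullback_comp,
      CechPic.pullback_comp, h1, cechPic_pullback_unitSlice_detClass_eq_one (DualPair.selfBundle D) hD₁, map_one]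
  refine (nonempty_iso_iff_detClass_eq (hasRank_pullback _ hR) D.hasRank_one (hR₁.pullback _) hD₁).2 ?_
  erw [detClass_pullback (hE := hR₁), detClass_rigidify h₀ hR₁, map_mul, map_inv, h1, h2, inv_one, _root_.mul_one]

end Literature.AlgebraicGeometry.AbelianSchemes.AbelianSchemeOver

end
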